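import Mathlib
import HarnessLib
import Summits.HubbardSuperconductivity.HubbardSuperconductivity.Theorems.KLProgrammeKLRegimeTwoVolumeTowerBaseSrcWindowRows
import Summits.HubbardSuperconductivity.HubbardSuperconductivity.Theorems.KLProgrammeKLRegimeTwoVolumeSourceSmoothDefs

/-!
# Route `KLProgramme` — K3 VL child (stmt-HubbardSuperconductivity-23356 `KLRegimeVolumeLimitV17F3`), atom HUV (`stub_vl_srcUV`, windowed currency HUV-W,
# pen (R295) «(VL)-HUV-CURRENCY»), part 1: the FIRST TIME MOMENT of the window kernel and the tree-weighted torus sum of the window family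

Cell `gate-hubbard-kl`, seat p3 (g20).  The doubled one-step bound `EngineV8.srcPinnedSum_cutoff_le_of_wgridStep[_full]` (p671194) reads an output
matrix `T` on the doubled labels through its rows / columns weighted by the scale-`0` TREE WEIGHT
`gridLabelWt L (4M) β {srcLegPos X″, gridLegPos X′} = 1 + |τ″ − τ′|_β + |x⃗″ − x⃗′|_T` (physical imaginary-time distance plus torus distance).  For the
windowed analysis `T = klSrcAnalysisAtW L M β μ K J` (copy `0` = `E(F_J[K])`, copy `1` = the frequency-window block `E(F_χ)` in sector slot `0`) the
copy-`1` rows need the FIRST TIME MOMENT of the window kernel, which p3 g18's `windowBlock_wtRows_le` (spatial weight only) does not carry.  This file adds it: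

* §1 `sum_cyclicDist_mul_norm_weightedCharSum_le` — `Σ_{d ∈ ℤ/4M} |d|_{4M}·‖Σ_{j<2M} w_j χ_j(d)‖ ≤ (2M+2)·v₂·M²·2(1 + log 4M)` from g18's pointwise bound
  `‖…‖ ≤ V₂M²(v⁻² + (4M−v)⁻²)` and the harmonic sum (`harmonic_le_one_add_log`);
* §2 `srcWindowSeq_props` — the window sequence `w_m = χ((2m+1−2M)/M)` vanishes at `0` and beyond `2M`, `|w| ≤ 1`, `|Δ²w| ≤ 4c₂/M²` (g18's derivation, exported);
* §3 `srcWindowFamily_torusSum_gridWt_le` — the product-torus sum of `F_χ` with the tree weight `1 + (β/4M)|d|_{4M} + |w⃗|_T` is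
  `≤ (M/β)·2(1 + 32c₂) + 8c₂(1 + log 4M)`;
(Part 2, `…EngineScaleOneSrcWindowWtRows`, turns §3 into the tree-weighted rows / columns of the window block and of `klSrcAnalysisAtW · S_{4M}` — the
`hrow'` / `hcol'` inputs of p671194 in the windowed currency.)

`T_χ` is `M`-uniform once `β(1 + log 4M) ≤ M` (the HUV binder order `… ∀ β …, ∃ M₁ …` allows it).  Proofs only; no definition; nothing asserts HUV, any stub,
VL, K3 or superconductivity.
[cite: BenfattoGiulianiMastropietro2006, §2.7 (2.70)–(2.71a), §3 (3.2)–(3.8)]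
-/

noncomputable section

namespace Summit.HubbardSuperconductivity.HubbardSuperconductivity.Theorems.TwoVolumeSource

set_option linter.dupNamespace false -- summit = problem name (single-conjunct summit), D-0017

open Finset Complex Literature.MathematicalPhysics.QuantumLattice GrassmannAlgebra Literature.Probability.LatticeModels
open Summit.HubbardSuperconductivity.HubbardSuperconductivity.Theorems.KLProgrammeLegKernels
open Summit.HubbardSuperconductivity.HubbardSuperconductivity.Theorems.KLRegimeSplit
open Summit.HubbardSuperconductivity.HubbardSuperconductivity.Theorems.EngineV8
open Summit.HubbardSuperconductivity.HubbardSuperconductivity.Theorems.TwoVolumeDefect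
open scoped ComplexConjugate Real

/-! ## §1 The first time moment of a weighted half-range character sum -/

/-- `Σ_{1 ≤ v < N} v⁻¹ ≤ 1 + log N` (the harmonic bound). [folklore] -/
theorem sum_Ico_inv_le_one_add_log (N : ℕ) : ∑ v ∈ Finset.Ico 1 N, ((v : ℕ) : ℝ)⁻¹ ≤ 1 + Real.log N := by
  have h := harmonic_le_one_add_log N
  simp_rw [harmonic_eq_sum_Icc, Rat.cast_sum, Rat.cast_inv, Rat.cast_natCast] at h
  refine le_trans (Finset.sum_le_sum_of_subset_of_nonneg (fun v hv => ?_) fun v _ _ => by positivity) h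
  rw [Finset.mem_Ico] at hv
  rw [Finset.mem_Icc]
  omega

/-- **THE FIRST TIME MOMENT OF THE WEIGHTED CHARACTER SUMS**: for weights `w` vanishing at `j = 0` and for `j ≥ 2M` with second differences
`‖w_j − 2w_{j−1} + w_{j−2}‖ ≤ v₂`, `Σ_{d ∈ ℤ/4M} |d|_{4M}·‖Σ_{j<2M} w_j χ_j(d)‖ ≤ (2M+2)·v₂·M²·2(1 + log 4M)` (pointwise
`‖…‖ ≤ V₂M²(v⁻² + (4M−v)⁻²)`, `|v|_{4M} ≤ v, 4M − v`, and the harmonic sum). [folklore] -/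
theorem sum_cyclicDist_mul_norm_weightedCharSum_le (M : ℕ) [NeZero M] (w : ℕ → ℂ) (hw0 : w 0 = 0) (hw2M : ∀ m, 2 * M ≤ m → w m = 0) {v₂ : ℝ}
    (hv : ∀ m, ‖w m - 2 * w (m - 1) + w (m - 2)‖ ≤ v₂) :
    ∑ d : TorusSite 1 (2 * (2 * M)), cyclicDist (2 * (2 * M)) (d 0) 0 *
        ‖∑ j : Fin (2 * M), w j * torusChar (fun _ : Fin 1 => ((j : ℕ) : ZMod (2 * (2 * M)))) d‖ ≤
      (2 * M + 2) * v₂ * (M : ℝ) ^ 2 * (2 * (1 + Real.log (2 * (2 * M) : ℕ))) := by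
  classical
  have hM0 : (0 : ℝ) < M := Nat.cast_pos.2 (Nat.pos_of_ne_zero (NeZero.ne M))
  set N : ℕ := 2 * (2 * M) with hN
  have hNpos : 0 < N := by rw [hN]; have := NeZero.ne M; omega
  haveI : NeZero N := ⟨hNpos.ne'⟩
  set h : ZMod N → ℝ := fun a => ‖∑ j : Fin (2 * M), w j * torusChar (fun _ : Fin 1 => ((j : ℕ) : ZMod N)) (fun _ : Fin 1 => a)‖ with hh
  set g : ZMod N → ℝ := fun a => cyclicDist N a 0 * h a with hg
  -- (i) the sum over `TorusSite 1 N` is the sum over the representatives `v < N`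
  have hequiv : ∑ d : TorusSite 1 N, cyclicDist N (d 0) 0 * ‖∑ j : Fin (2 * M), w j * torusChar (fun _ : Fin 1 => ((j : ℕ) : ZMod N)) d‖ =
      ∑ a : ZMod N, g a := by
    refine Fintype.sum_equiv (Equiv.funUnique (Fin 1) (ZMod N)) _ _ fun d => ?_
    have hd : (fun _ : Fin 1 => d default) = d := by
      funext i
      rw [Fin.eq_zero i]
      rfl
    simp only [hg, hh, Equiv.funUnique_apply, hd]
    rfl
  have hbij : Function.Bijective (fun i : Fin N => ((i : ℕ) : ZMod N)) := by
    rw [Fintype.bijective_iff_injective_and_card]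
    refine ⟨fun i i' hii' => ?_, by simp [ZMod.card]⟩
    have hval := congr_arg ZMod.val hii'
    simp only [ZMod.val_cast_of_lt i.isLt, ZMod.val_cast_of_lt i'.isLt] at hval
    exact Fin.ext hval
  have hrange : ∑ a : ZMod N, g a = ∑ v ∈ Finset.range N, g ((v : ℕ) : ZMod N) := by
    rw [← Fintype.sum_bijective _ hbij (fun i : Fin N => g ((i : ℕ) : ZMod N)) g fun i => rfl]
    exact Fin.sum_univ_eq_sum_range (fun v => g ((v : ℕ) : ZMod N)) N
  -- (ii) the zero difference carries no moment
  have hzero : g ((0 : ℕ) : ZMod N) = 0 := by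
    simp only [hg, Nat.cast_zero, (isLabelDist_cyclicDist N).self, zero_mul]
  -- (iii) the nonzero differences
  have hV : ∑ m ∈ Finset.range (2 * M + 2), ‖w m - 2 * w (m - 1) + w (m - 2)‖ ≤ (2 * M + 2) * v₂ := by
    calc ∑ m ∈ Finset.range (2 * M + 2), ‖w m - 2 * w (m - 1) + w (m - 2)‖ ≤ ∑ m ∈ Finset.range (2 * M + 2), v₂ :=
          Finset.sum_le_sum fun m _ => hv m
      _ = (2 * M + 2) * v₂ := by rw [Finset.sum_const, Finset.card_range, nsmul_eq_mul]; push_cast; ring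
  have hv₂0 : 0 ≤ v₂ := le_trans (norm_nonneg _) (hv 0)
  have hcyc : ∀ v ∈ Finset.Ico 1 N, cyclicDist N ((v : ℕ) : ZMod N) 0 ≤ (v : ℝ) ∧ cyclicDist N ((v : ℕ) : ZMod N) 0 ≤ ((N - v : ℕ) : ℝ) := by
    intro v hvI
    rw [Finset.mem_Ico] at hvI
    have hval : (((v : ℕ) : ZMod N) - 0).val = v := by rw [sub_zero, ZMod.val_cast_of_lt hvI.2]
    simp only [cyclicDist, hval]
    exact ⟨by exact_mod_cast min_le_left _ _, by exact_mod_cast min_le_right _ _⟩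
  have hpt : ∀ v ∈ Finset.Ico 1 N, g ((v : ℕ) : ZMod N) ≤
      (2 * M + 2) * v₂ * (M : ℝ) ^ 2 * ((((v : ℕ) : ℝ))⁻¹ + (((N - v : ℕ) : ℝ))⁻¹) := fun v hvI => by
    have hvI' := hvI
    rw [Finset.mem_Ico] at hvI'
    have hb := norm_weightedCharSum_le_of_ne_zero M w hw0 hw2M hV hvI'.1 hvI'.2
    have hv0 : (0 : ℝ) < v := Nat.cast_pos.2 (by omega)
    have hNv0 : (0 : ℝ) < ((N - v : ℕ) : ℝ) := Nat.cast_pos.2 (by omega)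
    obtain ⟨hc1, hc2⟩ := hcyc v hvI
    have hc0 : 0 ≤ cyclicDist N ((v : ℕ) : ZMod N) 0 := Nat.cast_nonneg _
    have hK0 : 0 ≤ (2 * M + 2) * v₂ * (M : ℝ) ^ 2 := by positivity
    -- `|v|·(v⁻² + (N−v)⁻²) ≤ v⁻¹ + (N−v)⁻¹`
    have hkey : cyclicDist N ((v : ℕ) : ZMod N) 0 * ((((v : ℕ) : ℝ) ^ 2)⁻¹ + (((N - v : ℕ) : ℝ) ^ 2)⁻¹) ≤
        (((v : ℕ) : ℝ))⁻¹ + (((N - v : ℕ) : ℝ))⁻¹ := by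
      rw [mul_add]
      refine add_le_add ?_ ?_
      · calc cyclicDist N ((v : ℕ) : ZMod N) 0 * (((v : ℕ) : ℝ) ^ 2)⁻¹ ≤ (v : ℝ) * (((v : ℕ) : ℝ) ^ 2)⁻¹ :=
            mul_le_mul_of_nonneg_right hc1 (by positivity)
          _ = ((v : ℕ) : ℝ)⁻¹ := by field_simp
      · calc cyclicDist N ((v : ℕ) : ZMod N) 0 * (((N - v : ℕ) : ℝ) ^ 2)⁻¹ ≤ ((N - v : ℕ) : ℝ) * (((N - v : ℕ) : ℝ) ^ 2)⁻¹ :=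
            mul_le_mul_of_nonneg_right hc2 (by positivity)
          _ = ((N - v : ℕ) : ℝ)⁻¹ := by field_simp
    calc g ((v : ℕ) : ZMod N) = cyclicDist N ((v : ℕ) : ZMod N) 0 * h ((v : ℕ) : ZMod N) := rfl
      _ ≤ cyclicDist N ((v : ℕ) : ZMod N) 0 * ((2 * M + 2) * v₂ * (M : ℝ) ^ 2 * ((((v : ℕ) : ℝ) ^ 2)⁻¹ + (((N - v : ℕ) : ℝ) ^ 2)⁻¹)) :=
          mul_le_mul_of_nonneg_left hb hc0
      _ = (2 * M + 2) * v₂ * (M : ℝ) ^ 2 * (cyclicDist N ((v : ℕ) : ZMod N) 0 * ((((v : ℕ) : ℝ) ^ 2)⁻¹ + (((N - v : ℕ) : ℝ) ^ 2)⁻¹)) := by ring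
      _ ≤ (2 * M + 2) * v₂ * (M : ℝ) ^ 2 * ((((v : ℕ) : ℝ))⁻¹ + (((N - v : ℕ) : ℝ))⁻¹) := mul_le_mul_of_nonneg_left hkey hK0
  -- (iv) the harmonic sums
  have hinv : ∑ v ∈ Finset.Ico 1 N, ((((v : ℕ) : ℝ))⁻¹ + (((N - v : ℕ) : ℝ))⁻¹) ≤ 2 * (1 + Real.log N) := by
    have hrefl : ∑ v ∈ Finset.Ico 1 N, (((N - v : ℕ) : ℝ))⁻¹ = ∑ v ∈ Finset.Ico 1 N, (((v : ℕ) : ℝ))⁻¹ := by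
      have h0 := Finset.sum_Ico_reflect (fun j : ℕ => (((j : ℕ) : ℝ))⁻¹) 1 (m := N) (n := N) (by omega)
      simp only [show N + 1 - N = 1 by omega, show N + 1 - 1 = N by omega] at h0
      exact h0
    rw [Finset.sum_add_distrib, hrefl]
    have := sum_Ico_inv_le_one_add_log N
    linarith
  -- (v) assemble
  have hsplit : ∑ v ∈ Finset.range N, g ((v : ℕ) : ZMod N) = g ((0 : ℕ) : ZMod N) + ∑ v ∈ Finset.Ico 1 N, g ((v : ℕ) : ZMod N) :=
    Finset.sum_range_eq_add_Ico _ hNpos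
  rw [hequiv, hrange, hsplit, hzero, zero_add]
  calc ∑ v ∈ Finset.Ico 1 N, g ((v : ℕ) : ZMod N)
      ≤ ∑ v ∈ Finset.Ico 1 N, (2 * M + 2) * v₂ * (M : ℝ) ^ 2 * ((((v : ℕ) : ℝ))⁻¹ + (((N - v : ℕ) : ℝ))⁻¹) := Finset.sum_le_sum hpt
    _ = (2 * M + 2) * v₂ * (M : ℝ) ^ 2 * ∑ v ∈ Finset.Ico 1 N, ((((v : ℕ) : ℝ))⁻¹ + (((N - v : ℕ) : ℝ))⁻¹) := by rw [Finset.mul_sum]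
    _ ≤ (2 * M + 2) * v₂ * (M : ℝ) ^ 2 * (2 * (1 + Real.log N)) := mul_le_mul_of_nonneg_left hinv (by positivity)

/-! ## §2 The window sequence -/

/-- **The window sequence** `w_m = χ((2m+1−2M)/M)` (`χ = srcWindowFn`, `|χ''| ≤ c₂`): `w_0 = 0`, `w_m = 0` for `m ≥ 2M`, `|w_m| ≤ 1`, and
`|w_m − 2w_{m−1} + w_{m−2}| ≤ 4c₂/M²` (truncated subtraction; p3 g18's derivation inside `windowBlock_wtRows_le`, exported). [folklore] -/
theorem srcWindowSeq_props (M : ℕ) [NeZero M] {c₂ : ℝ} (hc₂ : ∀ x : ℝ, |iteratedDeriv 2 srcWindowFn x| ≤ c₂) :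
    srcWindowFn ((2 * ((0 : ℕ) : ℝ) + 1 - 2 * M) / M) = 0 ∧
    (∀ m : ℕ, 2 * M ≤ m → srcWindowFn ((2 * (m : ℝ) + 1 - 2 * M) / M) = 0) ∧
    (∀ m : ℕ, |srcWindowFn ((2 * (m : ℝ) + 1 - 2 * M) / M)| ≤ 1) ∧
    (∀ m : ℕ, |srcWindowFn ((2 * (m : ℝ) + 1 - 2 * M) / M) - 2 * srcWindowFn ((2 * ((m - 1 : ℕ) : ℝ) + 1 - 2 * M) / M) +
        srcWindowFn ((2 * ((m - 2 : ℕ) : ℝ) + 1 - 2 * M) / M)| ≤ 4 * c₂ / (M : ℝ) ^ 2) := by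
  have hM0 : (0 : ℝ) < M := Nat.cast_pos.2 (Nat.pos_of_ne_zero (NeZero.ne M))
  have hM1 : (1 : ℝ) ≤ M := by exact_mod_cast Nat.pos_of_ne_zero (NeZero.ne M)
  have hc0 : 0 ≤ c₂ := le_trans (abs_nonneg _) (hc₂ 0)
  have hχ0 : ∀ x, 1 ≤ |x| → srcWindowFn x = 0 := fun x hx => srcWindowFn_eq_zero hx
  have hχ1 : ∀ x, |srcWindowFn x| ≤ 1 := fun x => by
    have h := srcWindowFn_mem_Icc x
    rw [abs_of_nonneg h.1]
    exact h.2
  set w : ℕ → ℝ := fun m => srcWindowFn ((2 * (m : ℝ) + 1 - 2 * M) / M) with hw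
  have hw0 : w 0 = 0 := by
    simp only [hw, Nat.cast_zero, mul_zero, zero_add]
    refine hχ0 _ (le_abs.2 (Or.inr ?_))
    have hid : -((1 - 2 * (M : ℝ)) / M) = 2 - 1 / M := by
      field_simp
      ring
    rw [hid]
    have h1M : 1 / (M : ℝ) ≤ 1 := by rw [div_le_one hM0]; exact hM1
    linarith
  have hw2M : ∀ m, 2 * M ≤ m → w m = 0 := fun m hm => by
    simp only [hw]
    refine hχ0 _ (le_abs.2 (Or.inl ?_))
    have hm' : (2 * M : ℝ) ≤ m := by exact_mod_cast hm
    rw [le_div_iff₀ hM0]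
    linarith
  have hv : ∀ m, |w m - 2 * w (m - 1) + w (m - 2)| ≤ 4 * c₂ / (M : ℝ) ^ 2 := by
    intro m
    rcases Nat.eq_zero_or_pos m with rfl | hm
    · show |w 0 - 2 * w 0 + w 0| ≤ 4 * c₂ / (M : ℝ) ^ 2
      have hz : w 0 - 2 * w 0 + w 0 = 0 := by ring
      rw [hz, abs_zero]
      positivity
    · set x₀ : ℝ := (2 * ((m - 1 : ℕ) : ℝ) + 1 - 2 * M) / M with hx₀
      have hcast : ((m - 1 : ℕ) : ℝ) = m - 1 := by
        rw [Nat.cast_sub hm]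
        simp
      have h1 : w m = srcWindowFn (x₀ + 2 / M) := by
        show srcWindowFn ((2 * (m : ℝ) + 1 - 2 * M) / M) = srcWindowFn (x₀ + 2 / M)
        congr 1
        rw [hx₀, hcast]
        field_simp
        ring
      have h2 : w (m - 1) = srcWindowFn x₀ := rfl
      have h3 : w (m - 2) = srcWindowFn (x₀ - 2 / M) := by
        rcases Nat.lt_or_ge m 2 with hm2 | hm2
        · have hl : w (m - 2) = 0 := by
            rw [show m - 2 = 0 by omega]
            exact hw0
          have hr : srcWindowFn (x₀ - 2 / M) = 0 := by
            refine hχ0 _ (le_abs.2 (Or.inr ?_))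
            rw [hx₀, show m - 1 = 0 by omega, Nat.cast_zero, mul_zero, zero_add]
            have hid : -((1 - 2 * (M : ℝ)) / M - 2 / M) = 2 + 1 / M := by
              field_simp
              ring
            rw [hid]
            have : 0 < 1 / (M : ℝ) := by positivity
            linarith
          rw [hl, hr]
        · have hcast2 : ((m - 2 : ℕ) : ℝ) = m - 2 := by
            rw [Nat.cast_sub hm2]
            simp
          show srcWindowFn ((2 * ((m - 2 : ℕ) : ℝ) + 1 - 2 * M) / M) = srcWindowFn (x₀ - 2 / M)
          congr 1
          rw [hx₀, hcast, hcast2]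
          field_simp
          ring
      rw [h1, h2, h3]
      calc |srcWindowFn (x₀ + 2 / M) - 2 * srcWindowFn x₀ + srcWindowFn (x₀ - 2 / M)| ≤ c₂ * (2 / M) ^ 2 :=
            abs_secondDiff_le (contDiff_srcWindowFn (n := 2)) hc₂ x₀ (2 / M)
        _ = 4 * c₂ / (M : ℝ) ^ 2 := by
          field_simp
          ring
  exact ⟨hw0, hw2M, fun m => hχ1 _, hv⟩

/-! ## §3 The tree-weighted product-torus sum of the window family -/

section Torus

variable {V M : ℕ} [NeZero V] [NeZero M]

/-- **THE TREE-WEIGHTED TORUS SUM OF THE WINDOW FAMILY**: for `F_χ = srcWindowFamily` (`|χ''| ≤ c₂`), every `β > 0`, every volume, every `M ≥ 1`: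
`(|β|V²)⁻¹ Σ_{(d,w⃗)} (1 + (β/4M)|d|_{4M} + |w⃗|_T)·‖Σ_k F_χ(k) Χ_c(k; d, w⃗)‖ ≤ (M/β)·2(1 + 32c₂) + 8c₂(1 + log 4M)` (the spatial difference is forced to
`0`; zeroth time moment by g18's `sum_norm_weightedCharSum_le`, first time moment by §1). [cite: BenfattoGiulianiMastropietro2006, §2.7 (2.71a)] -/
theorem srcWindowFamily_torusSum_gridWt_le {β : ℝ} (hβ : 0 < β) {c₂ : ℝ} (hc₂ : ∀ x : ℝ, |iteratedDeriv 2 srcWindowFn x| ≤ c₂) (ω : Fin 1) (c : Fin 2) :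
    1 / (|β| * (V : ℝ) ^ 2) * ∑ dw : TorusSite 1 (2 * (2 * M)) × TorusSite 2 V,
        (1 + (β / (2 * (2 * M) : ℕ) * cyclicDist (2 * (2 * M)) (dw.1 0) 0 + torusSiteDist dw.2 0)) *
          ‖∑ k : FreqMomentum V M, srcWindowFamily V M ω k *
            (if c = 0 then torusChar (fun _ : Fin 1 => ((k.1 : ℕ) : ZMod (2 * (2 * M)))) dw.1 * torusChar k.2 dw.2
              else conj (torusChar (fun _ : Fin 1 => ((k.1 : ℕ) : ZMod (2 * (2 * M)))) dw.1 * torusChar k.2 dw.2))‖ ≤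
      M / β * (2 * (1 + 32 * c₂)) + 8 * c₂ * (1 + Real.log (2 * (2 * M) : ℕ)) := by
  classical
  have hM0 : (0 : ℝ) < M := Nat.cast_pos.2 (Nat.pos_of_ne_zero (NeZero.ne M))
  have hV0 : (0 : ℝ) < V := Nat.cast_pos.2 (Nat.pos_of_ne_zero (NeZero.ne V))
  have hc0 : 0 ≤ c₂ := le_trans (abs_nonneg _) (hc₂ 0)
  have hβ' : |β| = β := abs_of_pos hβ
  obtain ⟨hw0, hw2M, hs, hv⟩ := srcWindowSeq_props M hc₂
  set w : ℕ → ℝ := fun m => srcWindowFn ((2 * (m : ℝ) + 1 - 2 * M) / M) with hw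
  have hF : ∀ k : FreqMomentum V M, srcWindowFamily V M ω k = ((w k.1 : ℝ) : ℂ) := fun k => by rw [srcWindowFamily_apply]
  simp_rw [hF, norm_freqOnlySum_eq w c]
  -- the time-torus sums
  set A : TorusSite 1 (2 * (2 * M)) → ℝ := fun d =>
    ‖∑ j : Fin (2 * M), ((w j : ℝ) : ℂ) * torusChar (fun _ : Fin 1 => ((j : ℕ) : ZMod (2 * (2 * M)))) d‖ with hA
  have hA0 : ∀ d, 0 ≤ A d := fun d => norm_nonneg _
  -- complexified hypotheses
  have hw0' : ((w 0 : ℝ) : ℂ) = 0 := by rw [show w 0 = 0 from hw0, Complex.ofReal_zero]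
  have hw2M' : ∀ m, 2 * M ≤ m → ((w m : ℝ) : ℂ) = 0 := fun m hm => by rw [show w m = 0 from hw2M m hm, Complex.ofReal_zero]
  have hs' : ∀ m, ‖((w m : ℝ) : ℂ)‖ ≤ 1 := fun m => by rw [Complex.norm_real, Real.norm_eq_abs]; exact hs m
  have hv' : ∀ m, ‖((w m : ℝ) : ℂ) - 2 * ((w (m - 1) : ℝ) : ℂ) + ((w (m - 2) : ℝ) : ℂ)‖ ≤ 4 * c₂ / (M : ℝ) ^ 2 := fun m => by
    have h : ((w m : ℝ) : ℂ) - 2 * ((w (m - 1) : ℝ) : ℂ) + ((w (m - 2) : ℝ) : ℂ) = ((w m - 2 * w (m - 1) + w (m - 2) : ℝ) : ℂ) := by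
      push_cast
      ring
    rw [h, Complex.norm_real, Real.norm_eq_abs]
    exact hv m
  have hzero : ∑ d : TorusSite 1 (2 * (2 * M)), A d ≤ 2 * M * (1 + 32 * c₂) := by
    have h := sum_norm_weightedCharSum_le M (fun m => ((w m : ℝ) : ℂ)) hw0' hw2M' hs' hv'
    rw [← hA] at h
    have h' : ∑ d : TorusSite 1 (2 * (2 * M)), A d ≤ 2 * M * (1 + 4 * M * (M + 1) * (4 * c₂ / (M : ℝ) ^ 2)) := by
      rw [mul_comm (2 * (M : ℝ)), ← div_le_iff₀ (by positivity)]
      calc (∑ d : TorusSite 1 (2 * (2 * M)), A d) / (2 * M) = 1 / (2 * (M : ℝ)) * ∑ d : TorusSite 1 (2 * (2 * M)), A d := by ring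
        _ ≤ _ := h
    have hb : 1 + 4 * (M : ℝ) * (M + 1) * (4 * c₂ / (M : ℝ) ^ 2) ≤ 1 + 32 * c₂ := by
      have hid : 4 * (M : ℝ) * (M + 1) * (4 * c₂ / (M : ℝ) ^ 2) = 16 * c₂ * (1 + 1 / M) := by
        field_simp
        ring
      rw [hid]
      have h1M : 1 / (M : ℝ) ≤ 1 := by rw [div_le_one hM0]; exact_mod_cast Nat.pos_of_ne_zero (NeZero.ne M)
      nlinarith
    exact h'.trans (mul_le_mul_of_nonneg_left hb (by positivity))
  have hfirst : ∑ d : TorusSite 1 (2 * (2 * M)), cyclicDist (2 * (2 * M)) (d 0) 0 * A d ≤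
      (2 * M + 2) * (4 * c₂ / (M : ℝ) ^ 2) * (M : ℝ) ^ 2 * (2 * (1 + Real.log (2 * (2 * M) : ℕ))) :=
    sum_cyclicDist_mul_norm_weightedCharSum_le M (fun m => ((w m : ℝ) : ℂ)) hw0' hw2M' hv'
  -- the spatial difference is forced to `0`
  have hred : ∑ dw : TorusSite 1 (2 * (2 * M)) × TorusSite 2 V,
      (1 + (β / (2 * (2 * M) : ℕ) * cyclicDist (2 * (2 * M)) (dw.1 0) 0 + torusSiteDist dw.2 0)) *
        (A dw.1 * (if dw.2 = 0 then (V : ℝ) ^ 2 else 0)) =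
      (V : ℝ) ^ 2 * (∑ d : TorusSite 1 (2 * (2 * M)), A d +
        β / (2 * (2 * M) : ℕ) * ∑ d : TorusSite 1 (2 * (2 * M)), cyclicDist (2 * (2 * M)) (d 0) 0 * A d) := by
    rw [Fintype.sum_prod_type]
    have hin : ∀ d : TorusSite 1 (2 * (2 * M)), ∑ x : TorusSite 2 V,
        (1 + (β / (2 * (2 * M) : ℕ) * cyclicDist (2 * (2 * M)) (d 0) 0 + torusSiteDist x 0)) * (A d * (if x = 0 then (V : ℝ) ^ 2 else 0)) =
        (V : ℝ) ^ 2 * (A d + β / (2 * (2 * M) : ℕ) * (cyclicDist (2 * (2 * M)) (d 0) 0 * A d)) := by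
      intro d
      rw [Fintype.sum_eq_single (0 : TorusSite 2 V) fun x hx => by rw [if_neg hx, mul_zero, mul_zero]]
      rw [if_pos rfl, (isLabelDist_torusSiteDist (L := V)).self 0]
      ring
    simp_rw [hin]
    rw [← Finset.mul_sum, Finset.sum_add_distrib, Finset.mul_sum]
  rw [hred]
  have hlog0 : 0 ≤ Real.log (2 * (2 * M) : ℕ) := Real.log_nonneg (by
    have : (1 : ℝ) ≤ M := by exact_mod_cast Nat.pos_of_ne_zero (NeZero.ne M)
    push_cast
    linarith)
  have hN : ((2 * (2 * M) : ℕ) : ℝ) = 4 * M := by push_cast; ring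
  -- assemble: `(1/β)·(2M(1+32c₂) + (β/4M)·16c₂(M+1)(1+log 4M)) ≤ (M/β)·2(1+32c₂) + 8c₂(1+log 4M)`
  have hfirst' : ∑ d : TorusSite 1 (2 * (2 * M)), cyclicDist (2 * (2 * M)) (d 0) 0 * A d ≤ 16 * c₂ * (M + 1) * (1 + Real.log (2 * (2 * M) : ℕ)) := by
    refine hfirst.trans (le_of_eq ?_)
    field_simp
    ring
  calc 1 / (|β| * (V : ℝ) ^ 2) * ((V : ℝ) ^ 2 * (∑ d : TorusSite 1 (2 * (2 * M)), A d +
        β / (2 * (2 * M) : ℕ) * ∑ d : TorusSite 1 (2 * (2 * M)), cyclicDist (2 * (2 * M)) (d 0) 0 * A d))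
      = 1 / β * ∑ d : TorusSite 1 (2 * (2 * M)), A d +
          1 / (4 * M) * ∑ d : TorusSite 1 (2 * (2 * M)), cyclicDist (2 * (2 * M)) (d 0) 0 * A d := by
        rw [hβ', hN]
        field_simp
    _ ≤ 1 / β * (2 * M * (1 + 32 * c₂)) + 1 / (4 * M) * (16 * c₂ * (M + 1) * (1 + Real.log (2 * (2 * M) : ℕ))) :=
        add_le_add (mul_le_mul_of_nonneg_left hzero (by positivity)) (mul_le_mul_of_nonneg_left hfirst' (by positivity))
    _ = M / β * (2 * (1 + 32 * c₂)) + 4 * c₂ * (1 + 1 / M) * (1 + Real.log (2 * (2 * M) : ℕ)) := by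
        field_simp
        ring
    _ ≤ M / β * (2 * (1 + 32 * c₂)) + 8 * c₂ * (1 + Real.log (2 * (2 * M) : ℕ)) := by
        have h1M : 1 / (M : ℝ) ≤ 1 := by rw [div_le_one hM0]; exact_mod_cast Nat.pos_of_ne_zero (NeZero.ne M)
        have : 4 * c₂ * (1 + 1 / M) * (1 + Real.log (2 * (2 * M) : ℕ)) ≤ 8 * c₂ * (1 + Real.log (2 * (2 * M) : ℕ)) := by
          have h2 : 4 * c₂ * (1 + 1 / (M : ℝ)) ≤ 8 * c₂ := by nlinarith
          exact mul_le_mul_of_nonneg_right h2 (by linarith)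
        linarith

end Torus

end Summit.HubbardSuperconductivity.HubbardSuperconductivity.Theorems.TwoVolumeSource

end
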